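/-
Copyright (c) 2026. All rights reserved.
Released under Apache 2.0 license as described in the file LICENSE.
-/
import Summits.HodgeConjecture.HodgeConjecture.Theorems.K2LiuArchKTypeScalars           -- ★ asm FILE 6 p861873 (`ladder_pair_from`, `kType_pair'`)
import HarnessLib

/-!
# Crux `HLiu418`, G6-arch ASSEMBLY FILE 7: LIVE ROUTES AT EVERY `s`, THE WHOLE `K_w`-TYPE, AND UNIQUENESS —
# at each `s` with `re s > ½`, `M_w(s)` acts on the ENTIRE type `W_{(k′,l′)} ⊂ ℂ[u, D⁻¹]` of `I_w(s,χ_k)` by ONE scalar, for EVERY section with that compact picture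

Cell `hodgecm-mathlib`, crux item hLiu418 = `stmt-HodgeConjecture-24832` (helper lane `--supports`, count-neutral).

★ asm FILE 6 gave the pair `(cp F, cp M_w F) = (A(s)•f, B(s)•f)` on the highest-weight vector `f = f_{k′,l′}` along the two straight routes.  A straight route can be DEAD
at isolated real `s` (`A(s) = 0`: a source scalar vanishes) — e.g. `s = 3∕2`, `k = 1`, `(k′,l′) = (5,−3)` kills both.  THIS FILE: (i) the general route through the
anchor `(0, l′+d)`, `0 ≤ d ≤ k′` — `d` clean `P₁₁`-arrows then `k′−d` clean `M₀₀`-arrows (`P₁₁` preserves `j+l`, `M₀₀` preserves `l`, so liveness depends on `d` only);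
(ii) **at every `s` with `re s > ½` SOME `d` is live** (`exists_route_live`: if `p(s) = s+1−k∕2` is an integer `t ∈ [l′+1, k′+l′]` take `d = t−1−l′`, else `d = k′`;
`p + q = 2s + 2` keeps the `M₀₀` factors `2s+1+j` off zero); (iii) the scalar propagates from `f_{k′,l′}` to the WHOLE type (the set of pictures carrying the pair
`(Q, c•Q)` is a submodule stable under `L₀₁`, `R₁₀` by ★ FILE 4 `rung_pair` with `𝔨`-letters, ★ S2-K `kType_le_of_fkl_mem`); (iv) uniqueness: two sections with the same
compact picture agree on `U(J)` (★ `eq_of_apply_kU_eq`), and `M_w F (g)` only reads `F` on `U(J)` (`archIntertwining_congr_UJ`).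
* §1 `archIntertwining_congr_UJ`; §2 `op_single_l01`, `op_single_r`; §3 **`kType_pair_via`** (route `d`); §4 **`exists_route_live`**;
* §5 **`forall_mem_kType_pair`** (whole type); §6 **`kType_scalar_at`** — `∃ c, ∀ Q ∈ W_{(k′,l′)}: (∃ F ∈ I_w(s,χ_k), cp F = Q ∧ cp M_w F = c•Q) ∧ (∀ F ∈ I_w(s,χ_k), cp F = Q →
  cp-values of M_w F = c•Q)` — the by-value scalar AT EACH `s`; its holomorphy in `s` on `{0 < re}` (odd `k`) is the next file.
References: [LeeZhu1998, §5 Prop. 5.4]; [KashiwaraVergne1978, §II.5]; [Shimura1982, (1.31)]; [Knapp1986, Ch. VIII §3].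
HONEST LABEL: HC_CM is proved only modulo the 7 printed citations (2 remaining named inputs: hLiu418 = stmt-HodgeConjecture-24832,
h413 = stmt-HodgeConjecture-24833) until rung 0 closes; count-neutral helper, closes no socket.
-/

set_option autoImplicit false
set_option linter.dupNamespace false

noncomputable section

open Complex Matrix MeasureTheory NormedSpace
open scoped ComplexConjugate ComplexOrder

namespace Summit.HodgeConjecture.HodgeConjecture.Cruxes.HLiu418.K2LiuArchKTypeRoutes

open Summit.HodgeConjecture.HodgeConjecture.Cruxes.HLiu418.K2LiuHermTwoGammaDefs (hermTwoGamma)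
open Summit.HodgeConjecture.HodgeConjecture.Cruxes.HLiu418.K2LiuHermitianTubeCocycle (mul_mem_UJ)
open Summit.HodgeConjecture.HodgeConjecture.Cruxes.HLiu418.K2LiuArchInducedTubeDefs
open Summit.HodgeConjecture.HodgeConjecture.Cruxes.HLiu418.K2LiuU22ShilovCoordinate (kU_mem_UJ)
open Summit.HodgeConjecture.HodgeConjecture.Cruxes.HLiu418.K2LiuU22CompactPictureDefs
open Summit.HodgeConjecture.HodgeConjecture.Cruxes.HLiu418.K2LiuU22CompactPictureOperatorDictionary
open Summit.HodgeConjecture.HodgeConjecture.Cruxes.HLiu418.K2LiuU22KTypeStructure (kType_le_of_fkl_mem)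
open Summit.HodgeConjecture.HodgeConjecture.Cruxes.HLiu418.K2LiuU22KTypeArrowClosure (mOp_zero_zero_fkl_carrier)
open Summit.HodgeConjecture.HodgeConjecture.Cruxes.HLiu418.K2LiuArchSWOnePlaceRegion (eq_of_apply_kU_eq det_ne_zero_of_unitary)
open Summit.HodgeConjecture.HodgeConjecture.Cruxes.HLiu418.K2LiuArchIntertwiningKTypeLadder (op_smul)
open Summit.HodgeConjecture.HodgeConjecture.Cruxes.HLiu418.K2LiuArchLadderPairTransport (pair_add pair_const_mul rung_pair scalar_of_pair)
open Summit.HodgeConjecture.HodgeConjecture.Cruxes.HLiu418.K2LiuArchLadderElementaryArrows (op_single_m)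
open Summit.HodgeConjecture.HodgeConjecture.Cruxes.HLiu418.K2LiuArchKTypeScalars (ladder_pair_from kType_pair')

/-! ## §1  `M_w F (g)` only reads `F` on `U(J)` -/

/-- two integrands agreeing on `U(J)` give the same `M_w` at `g ∈ U(J)` (`J·n(r)·g ∈ U(J)`). [folklore] -/
theorem archIntertwining_congr_UJ {F F' : Matrix (Fin 2 ⊕ Fin 2) (Fin 2 ⊕ Fin 2) ℂ → ℂ} (h : ∀ g : Matrix (Fin 2 ⊕ Fin 2) (Fin 2 ⊕ Fin 2) ℂ, gᴴ * Matrix.J (Fin 2) ℂ * g = Matrix.J (Fin 2) ℂ → F g = F' g)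
    {g : Matrix (Fin 2 ⊕ Fin 2) (Fin 2 ⊕ Fin 2) ℂ} (hg : gᴴ * Matrix.J (Fin 2) ℂ * g = Matrix.J (Fin 2) ℂ) : archIntertwining F g = archIntertwining F' g := by
  rw [archIntertwining_apply, archIntertwining_apply]
  exact integral_congr_ae (Filter.Eventually.of_forall fun r => h _ (mul_mem_UJ (J_mul_transl_hermOfReal_mem r) hg))

/-! ## §2  The `𝔨`-letters as quadruples -/

/-- `Op^{(k,s')}_{(E₀₁, 0, 0, 0)} P = −L₀₁ P` (`tr E₀₁ = 0`). [LeeZhu1998, §5] -/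
theorem op_single_l01 (k : ℤ) (s' : ℂ) (P : Carrier) :
    (∑ a' : Fin 2, ∑ b' : Fin 2, (0 : Matrix (Fin 2) (Fin 2) ℂ) a' b' • pOp pd uMat dInv (s' + 1 + (-(k : ℂ)) / 2) a' b' P +
          ∑ a' : Fin 2, ∑ b' : Fin 2, (0 : Matrix (Fin 2) (Fin 2) ℂ) a' b' • mOp pd uMat (s' + 1 - (-(k : ℂ)) / 2) a' b' P + ((-(k : ℂ)) * ((Matrix.single 0 1 (1 : ℂ) : Matrix (Fin 2) (Fin 2) ℂ)).trace) • P -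
          ∑ a' : Fin 2, ∑ b' : Fin 2, (Matrix.single 0 1 (1 : ℂ) : Matrix (Fin 2) (Fin 2) ℂ) a' b' • lOp pd uMat a' b' P + ∑ a' : Fin 2, ∑ b' : Fin 2, (0 : Matrix (Fin 2) (Fin 2) ℂ) a' b' • rOp pd uMat a' b' P) = -lOp pd uMat 0 1 P := by
  simp [Matrix.single_apply, Fin.sum_univ_two, Matrix.zero_apply]

/-- `Op^{(k,s')}_{(0, 0, 0, E_{ab})} P = R_{ab} P`. [LeeZhu1998, §5] -/
theorem op_single_r (k : ℤ) (s' : ℂ) (a b : Fin 2) (P : Carrier) :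
    (∑ a' : Fin 2, ∑ b' : Fin 2, (0 : Matrix (Fin 2) (Fin 2) ℂ) a' b' • pOp pd uMat dInv (s' + 1 + (-(k : ℂ)) / 2) a' b' P +
          ∑ a' : Fin 2, ∑ b' : Fin 2, (0 : Matrix (Fin 2) (Fin 2) ℂ) a' b' • mOp pd uMat (s' + 1 - (-(k : ℂ)) / 2) a' b' P + ((-(k : ℂ)) * ((0 : Matrix (Fin 2) (Fin 2) ℂ)).trace) • P -
          ∑ a' : Fin 2, ∑ b' : Fin 2, (0 : Matrix (Fin 2) (Fin 2) ℂ) a' b' • lOp pd uMat a' b' P + ∑ a' : Fin 2, ∑ b' : Fin 2, (Matrix.single a b (1 : ℂ)) a' b' • rOp pd uMat a' b' P) = rOp pd uMat a b P := by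
  fin_cases a <;> fin_cases b <;>
    simp [Matrix.single_apply, Fin.sum_univ_two, Matrix.zero_apply, Matrix.trace_zero]

/-! ## §3  The route through the anchor `(0, l′+d)` -/

/-- **ROUTE `d`** (`0 ≤ d ≤ k′`, `re s > ½`): `d` clean `P₁₁`-arrows from the one-dimensional anchor `(0, d+l′)` down to `(d, l′)` (★ FILE 6 `kType_pair'`), then `k′−d` clean
`M₀₀`-arrows along the row `l′` up to `(k′, l′)`: `∃ F ∈ I_w(s,χ_k)` with `cp F = A_d(s) • f_{k′,l′}`, `cp M_w F = B_d(s) • f_{k′,l′}`,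
`A_d(s) = ∏_{j<d}(p(s) − (d+l′−j)) · ∏_{j<k′−d}(q(s) + d + j + l′)`, `B_d(s) = c_{k,d+l′}(s) · (same at −s)`, `p(s) = s+1+(−k)∕2`, `q(s) = s+1−(−k)∕2`. [LeeZhu1998, §5 p. 5032] -/
theorem kType_pair_via (k : ℤ) {s : ℂ} (hs : 1 / 2 < s.re) (k' : ℕ) (l' : ℤ) (d : ℕ) (hd : d ≤ k') :
    ∃ F : Matrix (Fin 2 ⊕ Fin 2) (Fin 2 ⊕ Fin 2) ℂ → ℂ, IsArchSiegelSection (fun z : ℂ => (conj z / ((‖z‖ : ℝ) : ℂ)) ^ k) s F ∧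
      (∀ (v : Matrix (Fin 2) (Fin 2) ℂ), vᴴ * v = 1 → ∀ hv : v.det ≠ 0, F ((2 : ℂ)⁻¹ • fromBlocks (1 + v) (-(I • (1 - v))) (I • (1 - v)) (1 + v) : Matrix (Fin 2 ⊕ Fin 2) (Fin 2 ⊕ Fin 2) ℂ) = evalAt v hv (((∏ j ∈ Finset.range d, ((s + 1 + (-(k : ℂ)) / 2) - (((d : ℤ) + l' - j : ℤ) : ℂ))) *
          (∏ j ∈ Finset.range (k' - d), ((s + 1 - (-(k : ℂ)) / 2) + ((d + j : ℕ) : ℂ) + l'))) • fkl uMat dz k' l')) ∧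
      (∀ (u : Matrix (Fin 2) (Fin 2) ℂ), uᴴ * u = 1 → ∀ hu' : u.det ≠ 0,
        archIntertwining F ((2 : ℂ)⁻¹ • fromBlocks (1 + u) (-(I • (1 - u))) (I • (1 - u)) (1 + u) : Matrix (Fin 2 ⊕ Fin 2) (Fin 2 ⊕ Fin 2) ℂ) = evalAt u hu' (((((1 / 8 : ℂ) * (((4 * Real.pi ^ 4 : ℝ) : ℂ) * cexp ((Real.pi * I) * (k + 2 * (((d : ℤ) + l' : ℤ) : ℂ))) * (hermTwoGamma (s + 1 - k / 2 - (((d : ℤ) + l' : ℤ) : ℂ)))⁻¹ *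
            (hermTwoGamma (s + 1 + k / 2 + (((d : ℤ) + l' : ℤ) : ℂ)))⁻¹ * (hermTwoGamma (2 * s) * (4 : ℂ) ^ (-(2 * s))))) *
          (∏ j ∈ Finset.range d, ((-s + 1 + (-(k : ℂ)) / 2) - (((d : ℤ) + l' - j : ℤ) : ℂ)))) *
          (∏ j ∈ Finset.range (k' - d), ((-s + 1 - (-(k : ℂ)) / 2) + ((d + j : ℕ) : ℂ) + l'))) • fkl uMat dz k' l')) := by
  obtain ⟨F₁, hF₁, h1, h2⟩ := kType_pair' k hs d l'
  obtain ⟨F, hF, hFQ, hFM⟩ := ladder_pair_from k hs hF₁ (fun _ => (0 : Matrix (Fin 2) (Fin 2) ℂ)) (fun _ => (0 : Matrix (Fin 2) (Fin 2) ℂ)) (fun _ => Matrix.single 0 0 (1 : ℂ)) (fun _ => (0 : Matrix (Fin 2) (Fin 2) ℂ))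
    (fun j => ((∏ j ∈ Finset.range d, ((s + 1 + (-(k : ℂ)) / 2) - (((d : ℤ) + l' - j : ℤ) : ℂ))) *
      ∏ i ∈ Finset.range j, ((s + 1 - (-(k : ℂ)) / 2) + ((d + i : ℕ) : ℂ) + l')) • fkl uMat dz (d + j) l')
    (fun j => ((((1 / 8 : ℂ) * (((4 * Real.pi ^ 4 : ℝ) : ℂ) * cexp ((Real.pi * I) * (k + 2 * (((d : ℤ) + l' : ℤ) : ℂ))) * (hermTwoGamma (s + 1 - k / 2 - (((d : ℤ) + l' : ℤ) : ℂ)))⁻¹ *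
            (hermTwoGamma (s + 1 + k / 2 + (((d : ℤ) + l' : ℤ) : ℂ)))⁻¹ * (hermTwoGamma (2 * s) * (4 : ℂ) ^ (-(2 * s))))) *
      (∏ j ∈ Finset.range d, ((-s + 1 + (-(k : ℂ)) / 2) - (((d : ℤ) + l' - j : ℤ) : ℂ)))) *
      ∏ i ∈ Finset.range j, ((-s + 1 - (-(k : ℂ)) / 2) + ((d + i : ℕ) : ℂ) + l')) • fkl uMat dz (d + j) l')
    (fun v hv hv' => by rw [h1 v hv hv', Finset.prod_range_zero, mul_one, Nat.add_zero])
    (fun u hu hu' => by rw [h2 u hu hu', Finset.prod_range_zero, mul_one, Nat.add_zero]) (k' - d)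
    (fun j _ => by rw [op_single_m, map_smul, mOp_zero_zero_fkl_carrier, smul_smul, Finset.prod_range_succ, ← Nat.add_assoc]; congr 1; ring)
    (fun j _ => by rw [op_single_m, map_smul, mOp_zero_zero_fkl_carrier, smul_smul, Finset.prod_range_succ, ← Nat.add_assoc]; congr 1; ring)
  refine ⟨F, hF, fun v hv hv' => ?_, fun u hu hu' => ?_⟩
  · rw [hFQ v hv hv', Nat.add_sub_of_le hd]
  · rw [hFM u hu hu', Nat.add_sub_of_le hd]

/-! ## §4  A live route exists at every `s` -/

/-- **SOME ROUTE IS LIVE AT EVERY `s` WITH `re s > ½`**: `∃ d ≤ k′`, `A_d(s) ≠ 0`.  If `p(s)` is an integer `t ∈ [l′+1, k′+l′]` take `d := t−1−l′` (the `P₁₁` factors are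
`t − (t−1−j) = 1+j`, the `M₀₀` factors `2s+1+j` since `p+q = 2s+2`); otherwise `d := k′` (all factors `p − t`, `t ∈ [l′+1, k′+l′]`). [LeeZhu1998, §5] -/
theorem exists_route_live (k : ℤ) (k' : ℕ) (l' : ℤ) {s : ℂ} (hs : 1 / 2 < s.re) :
    ∃ d : ℕ, d ≤ k' ∧
      ((∏ j ∈ Finset.range d, ((s + 1 + (-(k : ℂ)) / 2) - (((d : ℤ) + l' - j : ℤ) : ℂ))) *
          (∏ j ∈ Finset.range (k' - d), ((s + 1 - (-(k : ℂ)) / 2) + ((d + j : ℕ) : ℂ) + l'))) ≠ 0 := by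
  by_cases h : ∃ t : ℤ, l' + 1 ≤ t ∧ t ≤ (k' : ℤ) + l' ∧ (s + 1 + (-(k : ℂ)) / 2) = (t : ℂ)
  · obtain ⟨t, ht1, ht2, hp⟩ := h
    obtain ⟨d, hd⟩ : ∃ d : ℕ, (d : ℤ) = t - 1 - l' := ⟨(t - 1 - l').toNat, Int.toNat_of_nonneg (by omega)⟩
    have hd' : (d : ℂ) = (t : ℂ) - 1 - (l' : ℂ) := by exact_mod_cast hd
    refine ⟨d, by omega, mul_ne_zero (Finset.prod_ne_zero_iff.2 fun j hj => ?_) (Finset.prod_ne_zero_iff.2 fun j hj => ?_)⟩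
    · have hj' := Finset.mem_range.1 hj
      rw [hp, ← Int.cast_sub, Int.cast_ne_zero]
      omega
    · have e : (s + 1 - (-(k : ℂ)) / 2) + ((d + j : ℕ) : ℂ) + (l' : ℂ) = 2 * s + 1 + j := by
        push_cast
        linear_combination (-1 : ℂ) * hp + hd'
      rw [e]
      intro h0
      have hre := congrArg Complex.re h0
      simp only [add_re, mul_re, re_ofNat, im_ofNat, zero_mul, sub_zero, one_re, natCast_re, zero_re] at hre
      linarith
  · refine ⟨k', le_rfl, ?_⟩
    rw [Nat.sub_self, Finset.prod_range_zero, mul_one]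
    exact Finset.prod_ne_zero_iff.2 fun j hj h0 => h ⟨(k' : ℤ) + l' - j, by have := Finset.mem_range.1 hj; omega,
      by have := Finset.mem_range.1 hj; omega, sub_eq_zero.1 h0⟩

/-! ## §5  From the highest-weight vector to the whole type -/

/-- **THE SCALAR PROPAGATES TO THE WHOLE TYPE** (`re s > ½`): if some `F ∈ I_w(s,χ_k)` has `cp F = f_{k′,l′}`, `cp M_w F = c • f_{k′,l′}`, then EVERY `Q ∈ W_{(k′,l′)}` has such a section:
the pictures carrying the pair `(Q, c•Q)` form a submodule (★ FILE 4 `pair_add∕pair_const_mul`) stable under `L₀₁`, `R₁₀` (★ FILE 4 `rung_pair` with the `𝔨`-quadruples, §2),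
hence contain `W_{(k′,l′)}` (★ S2-K `kType_le_of_fkl_mem`).  No Schur lemma. [KashiwaraVergne1978, §II.5] [LeeZhu1998, Prop. 5.4] -/
theorem forall_mem_kType_pair (k : ℤ) {s : ℂ} (hs : 1 / 2 < s.re) (k' : ℕ) (l' : ℤ) (c : ℂ)
    (h : ∃ F : Matrix (Fin 2 ⊕ Fin 2) (Fin 2 ⊕ Fin 2) ℂ → ℂ, IsArchSiegelSection (fun z : ℂ => (conj z / ((‖z‖ : ℝ) : ℂ)) ^ k) s F ∧
      (∀ (v : Matrix (Fin 2) (Fin 2) ℂ), vᴴ * v = 1 → ∀ hv : v.det ≠ 0, F ((2 : ℂ)⁻¹ • fromBlocks (1 + v) (-(I • (1 - v))) (I • (1 - v)) (1 + v) : Matrix (Fin 2 ⊕ Fin 2) (Fin 2 ⊕ Fin 2) ℂ) = evalAt v hv (fkl uMat dz k' l')) ∧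
      (∀ (u : Matrix (Fin 2) (Fin 2) ℂ), uᴴ * u = 1 → ∀ hu' : u.det ≠ 0,
        archIntertwining F ((2 : ℂ)⁻¹ • fromBlocks (1 + u) (-(I • (1 - u))) (I • (1 - u)) (1 + u) : Matrix (Fin 2 ⊕ Fin 2) (Fin 2 ⊕ Fin 2) ℂ) = evalAt u hu' (c • fkl uMat dz k' l')))
    (Q : Carrier) (hQ : Q ∈ kType k' l') :
    ∃ F : Matrix (Fin 2 ⊕ Fin 2) (Fin 2 ⊕ Fin 2) ℂ → ℂ, IsArchSiegelSection (fun z : ℂ => (conj z / ((‖z‖ : ℝ) : ℂ)) ^ k) s F ∧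
      (∀ (v : Matrix (Fin 2) (Fin 2) ℂ), vᴴ * v = 1 → ∀ hv : v.det ≠ 0, F ((2 : ℂ)⁻¹ • fromBlocks (1 + v) (-(I • (1 - v))) (I • (1 - v)) (1 + v) : Matrix (Fin 2 ⊕ Fin 2) (Fin 2 ⊕ Fin 2) ℂ) = evalAt v hv Q) ∧
      (∀ (u : Matrix (Fin 2) (Fin 2) ℂ), uᴴ * u = 1 → ∀ hu' : u.det ≠ 0,
        archIntertwining F ((2 : ℂ)⁻¹ • fromBlocks (1 + u) (-(I • (1 - u))) (I • (1 - u)) (1 + u) : Matrix (Fin 2 ⊕ Fin 2) (Fin 2 ⊕ Fin 2) ℂ) = evalAt u hu' (c • Q)) := by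
  let S : Submodule ℂ Carrier :=
    { carrier := {Q : Carrier | ∃ F : Matrix (Fin 2 ⊕ Fin 2) (Fin 2 ⊕ Fin 2) ℂ → ℂ, IsArchSiegelSection (fun z : ℂ => (conj z / ((‖z‖ : ℝ) : ℂ)) ^ k) s F ∧
        (∀ (v : Matrix (Fin 2) (Fin 2) ℂ), vᴴ * v = 1 → ∀ hv : v.det ≠ 0, F ((2 : ℂ)⁻¹ • fromBlocks (1 + v) (-(I • (1 - v))) (I • (1 - v)) (1 + v) : Matrix (Fin 2 ⊕ Fin 2) (Fin 2 ⊕ Fin 2) ℂ) = evalAt v hv Q) ∧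
        (∀ (u : Matrix (Fin 2) (Fin 2) ℂ), uᴴ * u = 1 → ∀ hu' : u.det ≠ 0,
        archIntertwining F ((2 : ℂ)⁻¹ • fromBlocks (1 + u) (-(I • (1 - u))) (I • (1 - u)) (1 + u) : Matrix (Fin 2 ⊕ Fin 2) (Fin 2 ⊕ Fin 2) ℂ) = evalAt u hu' (c • Q))}
      add_mem' := by
        rintro Q₁ Q₂ ⟨F₁, hF₁, h₁, h₁'⟩ ⟨F₂, hF₂, h₂, h₂'⟩
        obtain ⟨h0, h1, h2⟩ := pair_add k hs hF₁ hF₂ Q₁ Q₂ (c • Q₁) (c • Q₂) h₁ h₂ h₁' h₂'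
        exact ⟨_, h0, h1, fun u hu hu' => by rw [h2 u hu hu', smul_add]⟩
      zero_mem' := ⟨fun _ => 0, fun p g _ _ => by simp, fun v hv hv' => by simp, fun u hu hu' => by simp [archIntertwining_apply]⟩
      smul_mem' := by
        rintro a Q ⟨F, hF, h₁, h₁'⟩
        obtain ⟨h0, h1, h2⟩ := pair_const_mul k s hF Q (c • Q) a h₁ h₁'
        exact ⟨_, h0, h1, fun u hu hu' => by rw [h2 u hu hu', smul_comm]⟩ }
  have hL : ∀ v ∈ S, lOp pd uMat 0 1 v ∈ S := by
    rintro Q ⟨F, hF, h₁, h₁'⟩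
    obtain ⟨h0, h1, h2⟩ := rung_pair k hs hF Q (c • Q) h₁ h₁' (Matrix.single 0 1 (1 : ℂ)) 0 0 0
    have hmem : -lOp pd uMat 0 1 Q ∈ S :=
      ⟨_, h0, fun v hv hv' => (h1 v hv hv').trans (by rw [op_single_l01]),
        fun u hu hu' => (h2 u hu hu').trans (by rw [op_smul, op_single_l01, smul_neg])⟩
    have := S.neg_mem hmem
    rwa [neg_neg] at this
  have hR : ∀ v ∈ S, rOp pd uMat 1 0 v ∈ S := by
    rintro Q ⟨F, hF, h₁, h₁'⟩
    obtain ⟨h0, h1, h2⟩ := rung_pair k hs hF Q (c • Q) h₁ h₁' 0 0 0 (Matrix.single 1 0 (1 : ℂ))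
    exact ⟨_, h0, fun v hv hv' => (h1 v hv hv').trans (by rw [op_single_r]), fun u hu hu' => (h2 u hu hu').trans (by rw [op_smul, op_single_r])⟩
  exact kType_le_of_fkl_mem S hL hR k' l' h hQ

/-! ## §6  The scalar at each `s`, for every section -/

/-- **THE SCALAR OF `M_w(s)` ON `W_{(k′,l′)}` AT EACH `s`** (`re s > ½`): there is `c ∈ ℂ` (the live route's `B_d(s)∕A_d(s)`) such that for EVERY `Q ∈ W_{(k′,l′)}`
(i) some `F ∈ I_w(s,χ_k)` has `cp F = Q`, `cp M_w F = c • Q` (flat section exists), and (ii) EVERY `F ∈ I_w(s,χ_k)` with `cp F = Q` has `M_w(s) F (k_u) = ev_u (c • Q)` for all unitary `u`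
(uniqueness on `U(J)` ★ `eq_of_apply_kU_eq` + §1).  [LeeZhu1998, §5 Prop. 5.4] [Shimura1982, (1.31)] -/
theorem kType_scalar_at (k : ℤ) {s : ℂ} (hs : 1 / 2 < s.re) (k' : ℕ) (l' : ℤ) :
    ∃ c : ℂ, ∀ Q : Carrier, Q ∈ kType k' l' →
      (∃ F : Matrix (Fin 2 ⊕ Fin 2) (Fin 2 ⊕ Fin 2) ℂ → ℂ, IsArchSiegelSection (fun z : ℂ => (conj z / ((‖z‖ : ℝ) : ℂ)) ^ k) s F ∧
        (∀ (v : Matrix (Fin 2) (Fin 2) ℂ), vᴴ * v = 1 → ∀ hv : v.det ≠ 0, F ((2 : ℂ)⁻¹ • fromBlocks (1 + v) (-(I • (1 - v))) (I • (1 - v)) (1 + v) : Matrix (Fin 2 ⊕ Fin 2) (Fin 2 ⊕ Fin 2) ℂ) = evalAt v hv Q) ∧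
        (∀ (u : Matrix (Fin 2) (Fin 2) ℂ), uᴴ * u = 1 → ∀ hu' : u.det ≠ 0,
        archIntertwining F ((2 : ℂ)⁻¹ • fromBlocks (1 + u) (-(I • (1 - u))) (I • (1 - u)) (1 + u) : Matrix (Fin 2 ⊕ Fin 2) (Fin 2 ⊕ Fin 2) ℂ) = evalAt u hu' (c • Q))) ∧
      (∀ F : Matrix (Fin 2 ⊕ Fin 2) (Fin 2 ⊕ Fin 2) ℂ → ℂ, IsArchSiegelSection (fun z : ℂ => (conj z / ((‖z‖ : ℝ) : ℂ)) ^ k) s F →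
        (∀ (v : Matrix (Fin 2) (Fin 2) ℂ), vᴴ * v = 1 → ∀ hv : v.det ≠ 0, F ((2 : ℂ)⁻¹ • fromBlocks (1 + v) (-(I • (1 - v))) (I • (1 - v)) (1 + v) : Matrix (Fin 2 ⊕ Fin 2) (Fin 2 ⊕ Fin 2) ℂ) = evalAt v hv Q) →
        ∀ (u : Matrix (Fin 2) (Fin 2) ℂ), uᴴ * u = 1 → ∀ hu' : u.det ≠ 0,
        archIntertwining F ((2 : ℂ)⁻¹ • fromBlocks (1 + u) (-(I • (1 - u))) (I • (1 - u)) (1 + u) : Matrix (Fin 2 ⊕ Fin 2) (Fin 2 ⊕ Fin 2) ℂ) = evalAt u hu' (c • Q)) := by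
  obtain ⟨d, hd, hA⟩ := exists_route_live k k' l' hs
  obtain ⟨F, hF, hFQ, hFM⟩ := kType_pair_via k hs k' l' d hd
  obtain ⟨h0, h1, h2⟩ := scalar_of_pair k s hF (fkl uMat dz k' l') _ _ hA hFQ hFM
  have key := forall_mem_kType_pair k hs k' l' _ ⟨_, h0, h1, h2⟩
  refine ⟨_, fun Q hQ => ⟨key Q hQ, fun F' hF' hF'Q u hu hu' => ?_⟩⟩
  obtain ⟨F'', hF'', hF''Q, hF''M⟩ := key Q hQ
  rw [archIntertwining_congr_UJ (fun g hg => eq_of_apply_kU_eq hF' hF'' (fun v hv => by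
    rw [hF'Q v hv (det_ne_zero_of_unitary hv), hF''Q v hv (det_ne_zero_of_unitary hv)]) hg) (kU_mem_UJ hu)]
  exact hF''M u hu hu'

end Summit.HodgeConjecture.HodgeConjecture.Cruxes.HLiu418.K2LiuArchKTypeRoutes

end
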